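import Summits.KontsevichZagierPeriods.KontsevichZagierPeriods.Theses.TerasomaMultiplication
import Literature.NumberTheory.Transcendental.KZProductIdeal
import Literature.NumberTheory.Transcendental.KZKernelConjectureForms
import Literature.NumberTheory.Transcendental.KZLogCalculusProofs
import Literature.NumberTheory.Transcendental.KZDominatedFamilyRelations
import Literature.NumberTheory.Transcendental.KZRegCalculusProofs

/-!
# `BetaCancellation` (stmt-KontsevichZagierPeriods-13633) — kernel form, values, summit-implied, calibration

Negative-knowledge / boundary lemmas of the crux disprover (cdisprove) for crux #4 of route
TerasomaMultiplication, `BetaCancellation` ("Beta classes are non-zero-divisors modulo the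
moves", two-term pinned form: for `0 < a, b ∈ ℚ` and `q = [t^{a-1}(1-t)^{b-1}] × r`,
`q' = [t^{a-1}(1-t)^{b-1}] × r'` pinned in the `KZ.IntegralRep.prod` convention,
`q ∼ q' → r ∼ r'`). Everything is sorry-free; axioms ⊆ {propext, Classical.choice, Quot.sound}.

* §1 `betaCancellation_iff` — the crux is `∀ a b > 0, KernelCancellation (betaKernel a b)`, where
  `KernelCancellation k` is the same statement for an arbitrary kernel `k` on `(0,1)` and
  `IsPinned k r q` packages the two pinning hypotheses.
* §2 `value_of_isPinned` (Fubini, unconditional), `integrableOn_betaKernel_and_integral_eq`,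
  `integral_betaKernel_pos` (`∫₀¹ = B(a,b) > 0`), `value_eq_of_isPinned_of_equivalent`
  (`q ∼ q' ⇒ value r = value r'`: no value-level counterexample exists).
* §3 `betaCancellation_of_kzKernelConjecture`, `betaCancellation_of_summit`,
  `not_summit_of_not_betaCancellation` — THE CRUX IS IMPLIED BY THE SUMMIT: a refutation would
  disprove the formalised Kontsevich–Zagier conjecture (cf. `KZ.piCancellation_of_kernel`).
* §4 witnesses: `polyKernelRep`, `isPinned_prod` (no vacuity), `not_equivalent_piRep_neg`.
* §5 `betaCancellation_one_one` — the instance `a = b = 1` HOLDS (slab move, coordinate rotation,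
  null boundary, transitivity); the open content of the crux is the non-integer regime.

Companions: `Negative/LoadBearing.lean`, `Negative/PiLink.lean` (`BetaCancellation → KZ.PiCancellation`).
References: Kontsevich–Zagier 2001 §1.1–1.2; Huber–Wüstholz 2022 App. A.
-/

noncomputable section

set_option linter.dupNamespace false

namespace Summit.KontsevichZagierPeriods.KontsevichZagierPeriods.BetaCancellationNegative

open MeasureTheory Set
open Literature.NumberTheory.Transcendental
open Literature.NumberTheory.Transcendental.KZ
open Literature.ModelTheory.ExponentialFields (IsSemialgebraic isSemialgebraic_univ)
open MvPolynomial (aeval X C)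
open Summit.KontsevichZagierPeriods.KontsevichZagierPeriods.Theses.TerasomaMultiplication
  (BetaCancellation)
open Literature.NumberTheory.Transcendental.KZreg (unitIoo isSemialgebraic_unitIoo volume_unitIoo)

/-! ## §1 Vocabulary: pinned products and the kernel form of the crux -/

/-- The crux-shaped domain `(0,1) × σ ⊆ ℝ^{1+n}` (Beta variable FIRST, as in
`KZ.IntegralRep.prod`). [folklore] -/
def pinDomain {n : ℕ} (σ : Set (Fin n → ℝ)) : Set (Fin (1 + n) → ℝ) :=
  {z | z (Fin.castAdd n 0) ∈ Ioo (0:ℝ) 1 ∧ (fun j => z (Fin.natAdd 1 j)) ∈ σ}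

/-- The crux-shaped integrand `k(z₀) · f(z₁, …, zₙ)`. [folklore] -/
def pinFun {n : ℕ} (k : ℝ → ℝ) (f : (Fin n → ℝ) → ℝ) : (Fin (1 + n) → ℝ) → ℝ :=
  fun z => k (z (Fin.castAdd n 0)) * f (fun j => z (Fin.natAdd 1 j))

/-- `q` is PINNED over `r` with kernel `k`: domain `(0,1) × σ`, integrand `k ⊗ f` on it (the two
hypotheses on `q`, resp. `q'`, in the crux). [folklore] -/
def IsPinned {n : ℕ} (k : ℝ → ℝ) (r : IntegralRep n) (q : IntegralRep (1 + n)) : Prop :=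
  q.domain = pinDomain r.domain ∧ EqOn q.integrand (pinFun k r.integrand) q.domain

/-- CANCELLATION BY THE KERNEL `k`: the crux with the Beta kernel replaced by an arbitrary
kernel `k : ℝ → ℝ` on `(0,1)`. [folklore] -/
def KernelCancellation (k : ℝ → ℝ) : Prop :=
  ∀ ⦃n m : ℕ⦄ (r : IntegralRep n) (r' : IntegralRep m) (q : IntegralRep (1 + n))
    (q' : IntegralRep (1 + m)),
    IsPinned k r q → IsPinned k r' q' → Equivalent q q' → Equivalent r r'

/-- The Beta kernel `t^{a-1} (1-t)^{b-1}` of the crux. [folklore] -/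
def betaKernel (a b : ℚ) : ℝ → ℝ := fun t => t ^ ((a:ℝ) - 1) * (1 - t) ^ ((b:ℝ) - 1)

/-- **The crux unfolded**: `BetaCancellation` is `KernelCancellation (betaKernel a b)` for all
positive rationals `a, b`. [folklore] -/
theorem betaCancellation_iff :
    BetaCancellation ↔ ∀ a b : ℚ, 0 < a → 0 < b → KernelCancellation (betaKernel a b) := by
  constructor
  · intro h a b ha hb n m r r' q q' hq hq' hqq'
    exact h a b ha hb r r' q q' hq.1 hq.2 hq'.1 hq'.2 hqq'
  · intro h a b ha hb n m r r' q q' hd hi hd' hi' hqq'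
    exact h a b ha hb r r' q q' ⟨hd, hi⟩ ⟨hd', hi'⟩ hqq'

/-! ## §2 Values: `value q = (∫₀¹ k) · value r` for a pinned `q` (Fubini, unconditional) -/

/-- **Fubini for pinned representations**: if `q` is pinned over `r` with kernel `k`, then
`value q = (∫_{(0,1)} k) · value r` — with Bochner conventions this needs NO integrability
(`MeasureTheory.setIntegral_prod_mul`). [folklore] -/
theorem value_of_isPinned {n : ℕ} {k : ℝ → ℝ} {r : IntegralRep n} {q : IntegralRep (1 + n)}
    (h : IsPinned k r q) : q.value = (∫ t in Ioo (0:ℝ) 1, k t) * r.value := by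
  obtain ⟨hd, hi⟩ := h
  have hmeas : MeasurableSet q.domain := IntegralRep.measurableSet_domain_holds q
  rw [IntegralRep.value, setIntegral_congr_fun hmeas hi, hd]
  rw [← (volume_preserving_appendMeasurableEquiv (n := 1) (m := n)).setIntegral_preimage_emb
    (appendMeasurableEquiv 1 n).measurableEmbedding]
  have hpre : appendMeasurableEquiv 1 n ⁻¹' pinDomain r.domain =
      {x : Fin 1 → ℝ | x 0 ∈ Ioo (0:ℝ) 1} ×ˢ r.domain := by
    ext p
    simp only [mem_preimage, appendMeasurableEquiv_apply, pinDomain, mem_setOf_eq,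
      Fin.append_left, Fin.append_right, mem_prod]
  have hfun : ∀ p : (Fin 1 → ℝ) × (Fin n → ℝ),
      pinFun k r.integrand (appendMeasurableEquiv 1 n p) = k (p.1 0) * r.integrand p.2 := by
    intro p
    simp only [appendMeasurableEquiv_apply, pinFun, Fin.append_left, Fin.append_right]
  simp_rw [hfun]
  rw [hpre, Measure.volume_eq_prod,
    setIntegral_prod_mul (fun x : Fin 1 → ℝ => k (x 0)) r.integrand]
  congr 1
  have h1 := (volume_preserving_funUnique (Fin 1) ℝ).setIntegral_preimage_emb
    (MeasurableEquiv.funUnique (Fin 1) ℝ).measurableEmbedding k (Ioo (0:ℝ) 1)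
  rw [← h1]
  rfl

/-- **The Beta integral** on `(0,1)`: for `0 < a`, `0 < b` the Beta kernel is integrable on
`(0,1)` with integral `B(a,b) = Γ(a)Γ(b)/Γ(a+b)` (read off from Mathlib's normalised Beta
density `ProbabilityTheory.lintegral_betaPDF_eq_one`; same computation as the tree's private
`integrableOn_betaIntegrand_and_integral_eq` in `Literature/…/KontsevichZagier.lean`). [folklore] -/
theorem integrableOn_betaKernel_and_integral_eq {a b : ℚ} (ha : 0 < a) (hb : 0 < b) :
    IntegrableOn (betaKernel a b) (Ioo 0 1) ∧
      ∫ t in Ioo (0:ℝ) 1, betaKernel a b t = ProbabilityTheory.beta a b := by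
  have hα : (0:ℝ) < a := by exact_mod_cast ha
  have hβ : (0:ℝ) < b := by exact_mod_cast hb
  have hc0 : 0 < ProbabilityTheory.beta a b := ProbabilityTheory.beta_pos hα hβ
  set g : ℝ → ℝ := fun x => 1 / ProbabilityTheory.beta a b * x ^ ((a:ℝ) - 1) * (1 - x) ^ ((b:ℝ) - 1)
    with hg
  have hlin : ∫⁻ x in Ioo (0 : ℝ) 1, ENNReal.ofReal (g x) = 1 := by
    rw [hg, ← ProbabilityTheory.lintegral_betaPDF, ProbabilityTheory.lintegral_betaPDF_eq_one hα hβ]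
  have hg0 : 0 ≤ᵐ[volume.restrict (Ioo (0 : ℝ) 1)] g := by
    refine ae_restrict_of_forall_mem measurableSet_Ioo fun x hx => ?_
    have h1 : 0 ≤ x ^ ((a:ℝ) - 1) := Real.rpow_nonneg hx.1.le _
    have h2 : 0 ≤ (1 - x) ^ ((b:ℝ) - 1) := Real.rpow_nonneg (by linarith [hx.2]) _
    simp only [hg, Pi.zero_apply]
    exact mul_nonneg (mul_nonneg (by positivity) h1) h2
  have hgm : AEStronglyMeasurable g (volume.restrict (Ioo (0 : ℝ) 1)) :=
    Measurable.aestronglyMeasurable (by fun_prop)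
  have hgi : Integrable g (volume.restrict (Ioo (0 : ℝ) 1)) :=
    ⟨hgm, (hasFiniteIntegral_iff_ofReal hg0).2 (by simp [hlin])⟩
  have hgint : ∫ x in Ioo (0 : ℝ) 1, g x = 1 := by
    rw [integral_eq_lintegral_of_nonneg_ae hg0 hgm, hlin]; simp
  have hfg : betaKernel a b = fun x => ProbabilityTheory.beta a b * g x := by
    funext x
    simp only [hg, betaKernel]
    field_simp
  refine ⟨?_, ?_⟩
  · rw [hfg]; exact hgi.const_mul _
  · rw [hfg, integral_const_mul, hgint, mul_one]

/-- The Beta integral is positive. [folklore] -/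
theorem integral_betaKernel_pos {a b : ℚ} (ha : 0 < a) (hb : 0 < b) :
    0 < ∫ t in Ioo (0:ℝ) 1, betaKernel a b t := by
  rw [(integrableOn_betaKernel_and_integral_eq ha hb).2]
  exact ProbabilityTheory.beta_pos (by exact_mod_cast ha) (by exact_mod_cast hb)

/-- **Equivalent pinned representations have base representations of equal value** as soon as
`∫₀¹ k ≠ 0` (soundness of the calculus + Fubini). [folklore] -/
theorem value_eq_of_isPinned_of_equivalent {n m : ℕ} {k : ℝ → ℝ} (hk : ∫ t in Ioo (0:ℝ) 1, k t ≠ 0)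
    {r : IntegralRep n} {r' : IntegralRep m} {q : IntegralRep (1 + n)} {q' : IntegralRep (1 + m)}
    (hq : IsPinned k r q) (hq' : IsPinned k r' q') (hqq' : Equivalent q q') :
    r.value = r'.value := by
  have hv : q.value = q'.value := Equivalent.value_eq_holds hqq'
  rw [value_of_isPinned hq, value_of_isPinned hq'] at hv
  exact mul_left_cancel₀ hk hv

/-! ## §3 WHY IT RESISTS, I: the crux is implied by the summit

`KernelCancellation k` for ANY kernel with `∫₀¹ k ≠ 0` follows from the kernel form
`KZKernelConjecture` of Conjecture 1, which the tree proves EQUIVALENT to the summit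
(`kzKernelConjecture_iff_isRational`). Hence `¬ BetaCancellation → ¬ KontsevichZagierPeriods`:
a refutation of this crux is a disproof of the (formalised) Kontsevich–Zagier period conjecture,
exactly as for `KZ.PiCancellation` (`KZ.piCancellation_of_kernel`). No cheap kill exists unless the
summit itself is cheaply false. -/

/-- Kernel conjecture ⇒ cancellation by every kernel of non-zero integral. [folklore] -/
theorem kernelCancellation_of_kzKernelConjecture (hK : KZKernelConjecture) {k : ℝ → ℝ}
    (hk : ∫ t in Ioo (0:ℝ) 1, k t ≠ 0) : KernelCancellation k := by
  intro n m r r' q q' hq hq' hqq'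
  apply hK
  rw [KZ.eval_of_sub_of, value_eq_of_isPinned_of_equivalent hk hq hq' hqq', sub_self]

/-- **Kernel conjecture ⇒ `BetaCancellation`.** [folklore] -/
theorem betaCancellation_of_kzKernelConjecture (hK : KZKernelConjecture) : BetaCancellation :=
  betaCancellation_iff.2 fun _ _ ha hb =>
    kernelCancellation_of_kzKernelConjecture hK (integral_betaKernel_pos ha hb).ne'

/-- **Summit ⇒ `BetaCancellation`**: the crux is a CONSEQUENCE of the sub-problem statement, so
any counterexample to it refutes `KontsevichZagierPeriods`. [folklore] -/
theorem betaCancellation_of_summit (h : _root_.KontsevichZagierPeriods) : BetaCancellation :=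
  betaCancellation_of_kzKernelConjecture (kzKernelConjecture_iff_isRational.2 h)

/-- Contrapositive, the disprover's reading: **refuting the crux refutes the summit**. [folklore] -/
theorem not_summit_of_not_betaCancellation (h : ¬ BetaCancellation) :
    ¬ _root_.KontsevichZagierPeriods :=
  fun hs => h (betaCancellation_of_summit hs)

/-! ## §4 Witness representations -/

/-! The open unit interval `(0,1) ⊆ ℝ¹` in the crux's shape is the tree's `KZreg.unitIoo`
(`= {t | 0 < t 0 ∧ t 0 < 1}`, with `KZreg.isSemialgebraic_unitIoo`, `KZreg.volume_unitIoo`). -/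

/-- Membership in `unitIoo`, in the crux's `Set.Ioo` spelling. [folklore] -/
@[simp] theorem mem_unitIoo (x : Fin 1 → ℝ) : x ∈ unitIoo ↔ x 0 ∈ Ioo (0:ℝ) 1 := Iff.rfl

/-- `(0,1) ⊆ ℝ¹` is the open unit box. [folklore] -/
theorem unitIoo_eq_pi : unitIoo = Set.pi univ fun _ : Fin 1 => Ioo (0:ℝ) 1 := by
  ext x
  simp [KZreg.unitIoo, Fin.forall_fin_one]

/-- Continuous functions are integrable on `(0,1) ⊆ ℝ¹`. [folklore] -/
theorem integrableOn_unitIoo_of_continuous {f : (Fin 1 → ℝ) → ℝ} (hf : Continuous f) :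
    IntegrableOn f unitIoo := by
  have hK : IsCompact (Set.pi univ fun _ : Fin 1 => Icc (0:ℝ) 1) :=
    isCompact_univ_pi fun _ => isCompact_Icc
  refine (hf.continuousOn.integrableOn_compact hK).mono_set ?_
  rw [unitIoo_eq_pi]
  exact Set.pi_mono fun _ _ => Ioo_subset_Icc_self

/-- A kernel representation `[(0,1), p]` on `ℝ¹` for a `ℚ`-polynomial `p`. [folklore] -/
def polyKernelRep (p : MvPolynomial (Fin 1) ℚ) : IntegralRep 1 where
  domain := unitIoo
  integrand := fun x => aeval x p
  isSemialgebraic_domain := isSemialgebraic_unitIoo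
  isSemialgebraicFunOn_integrand := isSemialgebraicFunOn_aeval isSemialgebraic_unitIoo p
  integrableOn := by
    have hc : Continuous fun x : Fin 1 → ℝ => aeval x p := by
      have : (fun x : Fin 1 → ℝ => aeval x p) =
          fun x => MvPolynomial.eval x (p.map (algebraMap ℚ ℝ)) := by
        funext x
        rw [MvPolynomial.eval_map, MvPolynomial.aeval_def]
      rw [this]
      exact MvPolynomial.continuous_eval _
    exact integrableOn_unitIoo_of_continuous hc

/-- The domain of `polyKernelRep p`. [folklore] -/
@[simp] theorem polyKernelRep_domain (p : MvPolynomial (Fin 1) ℚ) :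
    (polyKernelRep p).domain = unitIoo := rfl

/-- The integrand of `polyKernelRep p`. [folklore] -/
@[simp] theorem polyKernelRep_integrand (p : MvPolynomial (Fin 1) ℚ) :
    (polyKernelRep p).integrand = fun x => aeval x p := rfl

/-- **Products with a kernel on `(0,1)` are pinned**: `κ.prod r` is pinned over `r` with kernel
`k` whenever `κ = [(0,1), k]`. In particular the hypotheses of the crux are satisfiable over
EVERY `r` (no vacuity) as soon as the kernel is semialgebraic and integrable on `(0,1)`.
[folklore] -/
theorem isPinned_prod {n : ℕ} {k : ℝ → ℝ} (κ : IntegralRep 1) (hκ : κ.domain = unitIoo)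
    (hk : ∀ x ∈ unitIoo, κ.integrand x = k (x 0)) (r : IntegralRep n) :
    IsPinned k r (κ.prod r) := by
  constructor
  · ext z
    simp only [IntegralRep.prod_domain, IntegralRep.mem_prodDomain, hκ, mem_unitIoo, pinDomain,
      mem_setOf_eq]
  · intro z hz
    rw [IntegralRep.prod_integrand_eq]
    simp only [IntegralRep.prod_domain, IntegralRep.mem_prodDomain, hκ] at hz
    simp only [IntegralRep.prodFun, pinFun, hk _ hz.1]

/-- `[π]` and `−[π]` are NOT equivalent (soundness: `π ≠ −π`). [folklore] -/
theorem not_equivalent_piRep_neg : ¬ Equivalent piRep piRep.neg := by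
  intro h
  have hv := Equivalent.value_eq_holds h
  rw [IntegralRep.value_neg, piRep_value] at hv
  linarith [Real.pi_pos]

/-- The Beta kernel at `a = b = 1` is the constant `1`. [folklore] -/
@[simp] theorem betaKernel_one_one : betaKernel 1 1 = fun _ => 1 := by
  funext t
  simp [betaKernel]

/-- `[(0,1), 1] × r` is pinned over `r` with the Beta kernel at `a = b = 1`. [folklore] -/
theorem isPinned_one_prod {n : ℕ} (r : IntegralRep n) :
    IsPinned (betaKernel 1 1) r ((polyKernelRep 1).prod r) :=
  isPinned_prod (polyKernelRep 1) rfl (fun x _ => by simp) r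

/-! ## §5 PROVABLE BOUNDARY CASE `a = b = 1` (calibration: the crux is TRUE at the trivial end)

With the constant kernel a pinned `q` is `[(0,1) × σ, f(tail)]`, which is ONE Newton–Leibniz move
(`KZ.IntegralRep.slab`, primitive `t · f`) plus one coordinate rotation (rule 2, `finAddFlip`)
plus a null boundary away from `r` itself; so `q ∼ r`, and cancellation is transitivity. The same
argument with the polynomial primitive of `t^{A}(1-t)^{B}` and `N · [σ, f/N] ∼ [σ, f]`
(`N = 1/B(A+1,B+1) ∈ ℕ`) proves every INTEGER instance; the open content of the crux is the
non-integer regime, where no semialgebraic primitive of the kernel exists. -/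

/-- A coordinate hyperplane `{w | w i = c} ⊆ ℝᵏ` is Lebesgue-null. [folklore] -/
theorem volume_setOf_apply_eq_zero {k : ℕ} (i : Fin k) (c : ℝ) :
    volume {w : Fin k → ℝ | w i = c} = 0 := by
  rw [volume_pi]
  exact Measure.pi_hyperplane _ _ _

/-- The unit slab over `r` with the slab coordinate FIRST: `[[0,1] × σ, f(tail)]`
(`KZ.IntegralRep.slab r 0` reindexed along `finAddFlip`). [folklore] -/
def slabFirst {n : ℕ} (r : IntegralRep n) : IntegralRep (1 + n) := (r.slab 0).reindex finAddFlip

/-- Pulling back along `finAddFlip`: the initial segment is the tail. [folklore] -/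
theorem init_comp_finAddFlip {n : ℕ} (w : Fin (1 + n) → ℝ) :
    Fin.init (fun i : Fin (n + 1) => w (finAddFlip i)) = fun j => w (Fin.natAdd 1 j) := by
  funext j
  simp only [Fin.init]
  rw [show Fin.castSucc j = Fin.castAdd 1 j from rfl, finAddFlip_apply_castAdd]

/-- `finAddFlip` sends the last coordinate to the head. [folklore] -/
theorem finAddFlip_last (n : ℕ) : finAddFlip (Fin.last n) = Fin.castAdd n (0 : Fin 1) := by
  rw [show Fin.last n = Fin.natAdd n (0 : Fin 1) from Fin.ext (by simp), finAddFlip_apply_natAdd]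

/-- The domain of `slabFirst r`. [folklore] -/
theorem slabFirst_domain {n : ℕ} (r : IntegralRep n) :
    (slabFirst r).domain = {w | (fun j => w (Fin.natAdd 1 j)) ∈ r.domain ∧
      0 ≤ w (Fin.castAdd n 0) ∧ w (Fin.castAdd n 0) ≤ 1} := by
  ext w
  simp only [slabFirst, IntegralRep.reindex_domain, IntegralRep.domain_slab,
    IntegralRep.slabDomain, mem_setOf_eq, init_comp_finAddFlip, finAddFlip_last, Nat.cast_zero,
    zero_add]

/-- The integrand of `slabFirst r` is `f(tail)`. [folklore] -/
theorem slabFirst_integrand {n : ℕ} (r : IntegralRep n) (w : Fin (1 + n) → ℝ) :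
    (slabFirst r).integrand w = r.integrand (fun j => w (Fin.natAdd 1 j)) := by
  simp only [slabFirst, IntegralRep.reindex_integrand, IntegralRep.integrand_slab,
    init_comp_finAddFlip]

/-- `r ∼ slabFirst r` (one Newton–Leibniz move and one coordinate rotation). [folklore] -/
theorem equivalent_slabFirst {n : ℕ} (r : IntegralRep n) : Equivalent r (slabFirst r) :=
  (r.equivalent_slab 0).trans (of_sub_of_reindex_mem_relations (r.slab 0) finAddFlip)

/-- **A representation pinned with the constant kernel `1` is equivalent to its base.**
[folklore] -/
theorem equivalent_of_isPinned_one {n : ℕ} {r : IntegralRep n} {q : IntegralRep (1 + n)}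
    (hq : IsPinned (fun _ => (1:ℝ)) r q) : Equivalent q r := by
  obtain ⟨hd, hi⟩ := hq
  have hE : IsSemialgebraic ℚ (pinDomain r.domain) := hd ▸ q.isSemialgebraic_domain
  have hEsub : pinDomain r.domain ⊆ (slabFirst r).domain := by
    intro w hw
    rw [slabFirst_domain]
    exact ⟨hw.2, hw.1.1.le, hw.1.2.le⟩
  have hvol : volume ((slabFirst r).domain \ pinDomain r.domain) = 0 := by
    refine measure_mono_null (fun w hw => ?_)
      (measure_union_null (volume_setOf_apply_eq_zero (Fin.castAdd n 0) 0)
        (volume_setOf_apply_eq_zero (Fin.castAdd n 0) 1))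
    rw [slabFirst_domain] at hw
    obtain ⟨⟨hσ, h0, h1⟩, hno⟩ := hw
    by_contra hc
    simp only [mem_union, mem_setOf_eq, not_or] at hc
    exact hno ⟨⟨lt_of_le_of_ne h0 (Ne.symm hc.1), lt_of_le_of_ne h1 hc.2⟩, hσ⟩
  have h1 := (slabFirst r).of_sub_of_restrict_mem_relations hE hEsub hvol
  have h2 : of ((slabFirst r).restrict _ hE hEsub) - of q ∈ relations := by
    refine of_sub_of_mem_relations_of_eqOn hd fun w hw => ?_
    simp only [IntegralRep.integrand_restrict, IntegralRep.domain_restrict] at hw ⊢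
    rw [hi (hd ▸ hw), slabFirst_integrand]
    simp [pinFun]
  have h3 : of r - of (slabFirst r) ∈ relations := equivalent_slabFirst r
  have : of r - of q = (of r - of (slabFirst r)) +
      (of (slabFirst r) - of ((slabFirst r).restrict _ hE hEsub)) +
      (of ((slabFirst r).restrict _ hE hEsub) - of q) := by abel
  apply Equivalent.symm
  show of r - of q ∈ relations
  rw [this]
  exact relations.add_mem (relations.add_mem h3 h1) h2

/-- **Cancellation by the constant kernel holds** (transitivity through the bases). [folklore] -/
theorem kernelCancellation_one : KernelCancellation (fun _ => (1:ℝ)) :=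
  fun _ _ _ _ _ _ hq hq' hqq' =>
    ((equivalent_of_isPinned_one hq).symm.trans hqq').trans (equivalent_of_isPinned_one hq')

/-- **`BetaCancellation` holds at `a = b = 1`** (kernel form). [folklore] -/
theorem kernelCancellation_betaKernel_one_one : KernelCancellation (betaKernel 1 1) := by
  rw [betaKernel_one_one]
  exact kernelCancellation_one

/-- **`BetaCancellation` holds at `a = b = 1`**, in the crux's literal shape. [folklore] -/
theorem betaCancellation_one_one :
    ∀ ⦃n m : ℕ⦄ (r : IntegralRep n) (r' : IntegralRep m) (q : IntegralRep (1 + n))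
      (q' : IntegralRep (1 + m)),
    q.domain = {z | z (Fin.castAdd n 0) ∈ Set.Ioo (0:ℝ) 1 ∧ (fun j => z (Fin.natAdd 1 j)) ∈ r.domain} →
    Set.EqOn q.integrand (fun z => (z (Fin.castAdd n 0)) ^ (((1:ℚ):ℝ) - 1) *
      (1 - z (Fin.castAdd n 0)) ^ (((1:ℚ):ℝ) - 1) * r.integrand (fun j => z (Fin.natAdd 1 j))) q.domain →
    q'.domain = {z | z (Fin.castAdd m 0) ∈ Set.Ioo (0:ℝ) 1 ∧ (fun j => z (Fin.natAdd 1 j)) ∈ r'.domain} →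
    Set.EqOn q'.integrand (fun z => (z (Fin.castAdd m 0)) ^ (((1:ℚ):ℝ) - 1) *
      (1 - z (Fin.castAdd m 0)) ^ (((1:ℚ):ℝ) - 1) * r'.integrand (fun j => z (Fin.natAdd 1 j))) q'.domain →
    Equivalent q q' → Equivalent r r' :=
  fun _ _ r r' q q' hd hi hd' hi' hqq' =>
    kernelCancellation_betaKernel_one_one r r' q q' ⟨hd, hi⟩ ⟨hd', hi'⟩ hqq'

end Summit.KontsevichZagierPeriods.KontsevichZagierPeriods.BetaCancellationNegative
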